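import Literature.AlgebraicGeometry.HodgeTheory.HodgeRiemannPolarizability
import Literature.AlgebraicGeometry.HodgeTheory.HodgeRiemannPrimitiveClasses
import Literature.AlgebraicGeometry.HodgeTheory.LefschetzDecompositionPolarizationForm
import Literature.AlgebraicGeometry.HodgeTheory.HodgeTypeProjectors
import Literature.AlgebraicGeometry.HodgeTheory.FubiniStudyClassRational
import Literature.AlgebraicGeometry.HodgeTheory.HardLefschetzNFoldOfPolarizationClass
import Literature.AlgebraicGeometry.Motives.HodgeDecompositionHardLefschetzDischarge
import HarnessLib

/-!
# The Hodge structure of a smooth projective variety is polarisable (Voisin I, §7.1.2) — proofs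

Layer `Literature/AlgebraicGeometry/HodgeTheory`, theorems and auxiliary definitions only (no named
facts, D-0026). Discharge of the named fact
`Literature.AlgebraicGeometry.HodgeTheory.smoothProjective_hodgeStructure_isPolarizable`
(`HodgeRiemannPolarizability.lean`; C. Voisin, *Hodge Theory and Complex Algebraic Geometry I*
(2002), §7.1.2: for `X` smooth projective the Hodge structure on `Hᵏ(X, ℚ)` is polarised by the
hyperplane class, from the hard Lefschetz theorem (Thm. 6.25), the Lefschetz decomposition
(Cor. 6.26) and the Hodge–Riemann bilinear relations (Thm. 6.32)), assembling the bricks of the tree: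

* B1 — hard Lefschetz `hasHardLefschetzProperty_kaehlerClass_holds` (hodge.S14);
* B2/B5 — the Hodge–Riemann relation on primitive `(p,q)`-classes `hodgeRiemann_primitiveClass`
  (hodge.S15 `hodge_riemann_bilinear_holds` and the harmonic primitive representative);
* B3 — a rational Kähler class: `exists_fubiniStudy_rational` (a positive multiple of the restricted
  Fubini–Study class is rational; surrogate of Thm. 7.10);
* B4/B6 — the polarisation form of the Lefschetz decomposition over `ℚ`
  (`LefschetzDecompositionPolarizationForm`) and the Hodge-type projectors (`HodgeTypeProjectors`).

Contents: the datum `KaehlerRationalDatum` (a real Hodge model `B`, a natural multiplicative real de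
Rham comparison `e`, a Kähler metric `g` on `X^an` and a RATIONAL class `η ∈ H²(X(ℂ); ℚ)` with
`B^* (η ⊗ 1) = e[ω_g] ⊗ 1`), its existence (`nonempty_kaehlerRationalDatum`), hard Lefschetz over `ℚ`
(`hasHardLefschetzProperty_rat`), the trace `H^{2n}(X(ℂ); ℚ) → ℚ` normalised so that the class of
`ω_gⁿ` has positive trace, the polarisation form `Q` and its complexification, the two Hodge–Riemann
relations, and the assembly `smoothProjective_hodgeStructure_isPolarizable_holds`; consequences:
`Voisin2025_hodgeClass_lift_complexGysin_holds` (its assembly was waiting only for the polarizability)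
and `curveNetSaitoData_nonempty_of_deligne` (Saito's curve-net datum from Deligne's Cor. 8.2.8 alone).

## References

* [VoisinHodgeI2002] C. Voisin, Hodge Theory and Complex Algebraic Geometry I (2002), §6.2.3
  Thm. 6.25, Cor. 6.26, Rem. 6.27; §6.3.2 Thm. 6.32, Rem. 6.33; §7.1.1 Def. 7.4; §7.1.2; §7.1.3
  Thm. 7.10.
* [DeligneHodgeII1971] P. Deligne, Théorie de Hodge II, 2.1.15.
* [DeligneHodgeIII1974] P. Deligne, Théorie de Hodge III, Cor. 8.2.8.
* [Voisin2025] C. Voisin, Hodge and generalized Hodge conjectures, coniveau and algebraic cycles (2025),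
  Cor. 2.12.
* [Saito1990] M. Saito, Mixed Hodge modules, Publ. RIMS 26 (1990), Thm. 0.1–0.2.
* [HatcherAT2002] A. Hatcher, Algebraic Topology (2002), §3.2 Prop. 3.10, Thm. 3.11, §3.3 Cor. 3.37.
-/

noncomputable section

open scoped Manifold ContDiff TensorProduct ComplexConjugate
open CategoryTheory Bundle Module
open Literature.AlgebraicTopology.SingularHomology Literature.Geometry.Kaehler
open Literature.NumberTheory.Transcendental (DeRhamIsoFamily complexDeRhamCohomology hodgePQ)
open Literature.AlgebraicGeometry.Motives (ofRatClassBaseChange ofRatClassBaseChange_tmul kaehlerFormPow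
  hasHardLefschetzProperty_kaehlerClass_holds)

namespace Literature.AlgebraicGeometry.HodgeTheory

section HodgeTheory

variable {n : ℕ} {X : Motives.SchemeOver ℂ}

/-! ### Vanishing above the top degree; conjugation and the Lefschetz operator of a real class -/

/-- `Hᵐ(X(ℂ); R) = 0` for `m > 2n`, in the form consumed by the Lefschetz-decomposition files.
[cite: HatcherAT2002, §3.3 (Prop. 3.29)] -/
theorem subsingleton_of_lt (hX : Motives.IsSmoothProjective n X) (F : Type) [Field F] :
    ∀ m, 2 * n < m → Subsingleton (singularCohomology F F (Motives.ComplexPoints X) m) :=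
  fun _ hm ↦ Motives.ComplexPoints.subsingleton_singularCohomology_of_lt hX F hm

/-- `conj (a ∪ b) = conj a ∪ conj b` on `H*(Y; ℂ)` (conjugation of Alexander–Whitney cochains is
multiplicative). Local copy of `conjClass_cupProduct` (file `WeilClassesDescendingTransfer`, not
imported to keep the closure small). [cite: VoisinHodgeI2002, Cor. 6.12] [cite: HatcherAT2002, §3.2 Prop. 3.10] -/
private theorem conjClass_cupProduct' {Y : Type} [TopologicalSpace Y] {p q m : ℕ} (h : p + q = m)
    (a : singularCohomology ℂ ℂ Y p) (b : singularCohomology ℂ ℂ Y q) :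
    conjClass Y m (cupProduct h a b) = cupProduct h (conjClass Y p a) (conjClass Y q b) := by
  induction a using singularCohomology_induction_on with
  | h za =>
    induction b using singularCohomology_induction_on with
    | h zb =>
      rw [cupProduct_π_π, conjClass_π, conjClass_π, conjClass_π, cupProduct_π_π]
      refine congrArg _ (singularCochainComplex.cocycles_ext ?_)
      rw [iCocycles_conjCocycle, singularCochainComplex.iCocycles_cocyclesCup,
        singularCochainComplex.iCocycles_cocyclesCup, iCocycles_conjCocycle, iCocycles_conjCocycle]
      exact singularCochainComplex.ext fun σ ↦ by
        simp only [conjCochain_apply, cochainCup_apply, map_mul]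

/-- Complex conjugation on `Hᵃ(Y; ℂ)` as an additive map (it is conjugate-linear). [folklore] -/
def conjClassHom (Y : Type) [TopologicalSpace Y] (a : ℕ) :
    singularCohomology ℂ ℂ Y a →+ singularCohomology ℂ ℂ Y a where
  toFun := conjClass Y a
  map_zero' := conjClass_zero
  map_add' := conjClass_add

/-- Unfolding of `conjClassHom`. [folklore] -/
@[simp]
theorem conjClassHom_apply (Y : Type) [TopologicalSpace Y] (a : ℕ) (c : singularCohomology ℂ ℂ Y a) :
    conjClassHom Y a c = conjClass Y a c :=
  rfl

/-- **Conjugation commutes with the Lefschetz operator of a REAL (e.g. rational) class**: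
`conj (κ ∪ x) = κ ∪ conj x` when `conj κ = κ`. [cite: VoisinHodgeI2002, Cor. 6.12 and §7.1.2] -/
theorem conjClass_lefschetzOperator {Y : Type} [TopologicalSpace Y] {κ : singularCohomology ℂ ℂ Y 2}
    (hκ : conjClass Y 2 κ = κ) (k l : ℕ) (h : 2 + k = l) (x : singularCohomology ℂ ℂ Y k) :
    conjClassHom Y l (lefschetzOperator κ h x) = lefschetzOperator κ h (conjClassHom Y k x) := by
  rw [conjClassHom_apply, conjClassHom_apply, lefschetzOperator_apply, lefschetzOperator_apply,
    conjClass_cupProduct', hκ]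

/-! ### The datum: real Hodge model, de Rham comparison, Kähler metric and rational Kähler class -/

variable (n X) in
/-- A **Kähler–rational datum** for the smooth projective `X` of dimension `n`: a Hodge model `B`,
a natural and multiplicative real de Rham comparison family `e` over the manifolds charted on
`B.model` (de Rham / Warner Thm. 5.36, 5.45), a Kähler metric `g` on `X^an = B.carrier`, and a
RATIONAL class `η ∈ H²(X(ℂ); ℚ)` whose complexification is the class of `ω_g`:
`B^*(η ⊗ 1) = e[ω_g] ⊗ 1` ("the Kähler class is integral", Voisin I §7.1.2 with Thm. 7.10 — here a
positive rational multiple of the restricted Fubini–Study class, `exists_fubiniStudy_rational`).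
[cite: VoisinHodgeI2002, §7.1.2 and Thm. 7.10] -/
structure KaehlerRationalDatum where
  /-- The Hodge model. -/
  B : HodgeModel n X
  /-- The real de Rham comparison family. -/
  e : DeRhamIsoFamily 𝓘(ℝ, B.model)
  /-- `e` is natural. -/
  isNatural : e.IsNatural
  /-- `e` is multiplicative. -/
  isMultiplicative : e.IsMultiplicative
  /-- The Kähler metric on `X^an`. -/
  g : ContMDiffRiemannianMetric 𝓘(ℝ, B.model) ∞ B.model (fun x : B.carrier ↦ TangentSpace 𝓘(ℝ, B.model) x)
  /-- `g` is Kähler. -/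
  isKaehler : g.toRiemannianMetric.IsKaehler
  /-- The rational Kähler class. -/
  η : singularCohomology ℚ ℚ (Motives.ComplexPoints X) 2
  /-- `B^*(η ⊗ 1) = e[ω_g] ⊗ 1`. -/
  pullback_eq : B.pullback 2 (ofRatClass (Motives.ComplexPoints X) 2 η) =
    ofRealClass B.carrier 2 (e B.carrier 2
      (g.kaehlerClass (isSmoothForm_kaehlerForm_of_isManifold_complex_holds
        (E := B.model) (M := B.carrier)) isKaehler))

/-- **Every smooth projective variety has a Kähler–rational datum**: `exists_fubiniStudy_rational`
gives a Hodge model `A`, a natural multiplicative `e`, the class `H` of the restricted Fubini–Study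
form `θ` and `r > 0` with `r H` rational; `θ` is the Kähler form of a Kähler metric (Voisin I §3.3.2
Lemma 3.16, `isKaehlerClassVia_of_pullback_eq_fubiniStudyPullbackForm`), so `r H` is the class of
the Kähler metric `r g` (`IsKaehlerClassVia.smul_of_pos`). [cite: VoisinHodgeI2002, §7.1.2, Thm. 7.10 and §3.3.2 Lemma 3.16] -/
theorem nonempty_kaehlerRationalDatum (hX : Motives.IsSmoothProjective n X) :
    Nonempty (KaehlerRationalDatum n X) := by
  obtain ⟨A, N, ι, hι, e, he, hem, hθ, H, r, hH, hr, hrat⟩ := exists_fubiniStudy_rational hX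
  haveI := hι
  have hKV : A.IsKaehlerClassVia e H :=
    A.isKaehlerClassVia_of_pullback_eq_fubiniStudyPullbackForm e hX ι hθ hH
  have hKV' : A.IsKaehlerClassVia e ((r : ℂ) • H) := hKV.smul_of_pos hr
  obtain ⟨η, hη⟩ := (isRationalClass_iff_mem_range_ofRatClass _).1 hrat
  obtain ⟨g, hg, hgH⟩ := hKV'
  exact ⟨⟨A, e, he, hem, g, hg, η, by rw [hη]; exact hgH⟩⟩

namespace KaehlerRationalDatum

variable (D : KaehlerRationalDatum n X)

/-- The complexified Kähler class `η ⊗ 1 ∈ H²(X(ℂ); ℂ)`. [cite: VoisinHodgeI2002, §7.1.2] -/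
abbrev Hη : complexBetti X 2 := ofRatClass (Motives.ComplexPoints X) 2 D.η

/-- The witness of the (discharged) smoothness fact used for the Kähler class of `D.g`. [folklore] -/
abbrev hω : isSmoothForm_kaehlerForm_of_isManifold_complex (E := D.B.model) (M := D.B.carrier) :=
  isSmoothForm_kaehlerForm_of_isManifold_complex_holds

/-- `η ⊗ 1` is a Kähler class of `(B, e)`. [cite: VoisinHodgeI2002, §3.1.3 and §7.1.2] -/
theorem isKaehlerClassVia : D.B.IsKaehlerClassVia D.e D.Hη :=
  ⟨D.g, D.isKaehler, D.pullback_eq⟩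

/-- `η ⊗ 1` is rational. [folklore] -/
theorem isRationalClass_Hη : IsRationalClass D.Hη :=
  isRationalClass_ofRatClass _

/-- `η ⊗ 1` is real: `conj (η ⊗ 1) = η ⊗ 1`. [cite: VoisinHodgeI2002, Cor. 6.12] -/
theorem conjClass_Hη : conjClass (Motives.ComplexPoints X) 2 D.Hη = D.Hη :=
  conjClass_ofRatClass _

/-- `η ⊗ 1 = φ_* η` for the inclusion `φ : ℚ → ℂ` (the spelling of the ring-change lemmas). [folklore] -/
theorem ringChange_eq : singularCohomology.ringChange (algebraMap ℚ ℂ) (Motives.ComplexPoints X) 2 D.η = D.Hη :=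
  (ofRatClass_eq_ringChange 2 D.η).symm

/-- **Hard Lefschetz for `η ⊗ 1`** in dimension `n` on `H•(X(ℂ); ℂ)` (hodge.S14
`hasHardLefschetzProperty_kaehlerClass_holds` on the compact Kähler `X^an`, transported).
[cite: VoisinHodgeI2002, Thm. 6.25 and Rem. 6.27] -/
theorem hasHardLefschetzProperty (hX : Motives.IsSmoothProjective n X) :
    HasHardLefschetzProperty D.Hη n :=
  D.isKaehlerClassVia.hasHardLefschetzProperty hX hasHardLefschetzProperty_kaehlerClass_holds
    D.isNatural D.isMultiplicative

/-- `φ_*` commutes with the Lefschetz iterates of `η` and `η ⊗ 1` (`lefschetzPow` spelling). [folklore] -/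
theorem ofRatClass_lefschetzPow (j k : ℕ) (x : singularCohomology ℚ ℚ (Motives.ComplexPoints X) k) :
    ofRatClass _ (k + 2 * j) (lefschetzPow D.η j k x) = lefschetzPow D.Hη j k (ofRatClass _ k x) := by
  have h := ringChange_lefschetzPowTo_of_eq (algebraMap ℚ ℂ) D.ringChange_eq j k (k + 2 * j) rfl x
  rw [← ofRatClass_eq_ringChange, ← ofRatClass_eq_ringChange] at h
  exact h

/-- **Hard Lefschetz over `ℚ`**: `Lʲ_η : Hᵏ(X(ℂ); ℚ) → H^{k+2j}(X(ℂ); ℚ)` is bijective for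
`k + j = n` ("the operator `L` acts on the rational cohomology", Voisin I §7.1.2: injective inside
`H•(X(ℂ); ℂ)`, surjective by rational descent `isRationalClass_of_lefschetzPow_of_hasHardLefschetzProperty`).
[cite: VoisinHodgeI2002, §7.1.2 and Thm. 6.25] -/
theorem hasHardLefschetzProperty_rat (hX : Motives.IsSmoothProjective n X) :
    Literature.Geometry.Kaehler.HasHardLefschetzProperty D.η n := by
  intro j k hkj
  have hC := D.hasHardLefschetzProperty hX j k hkj
  constructor
  · intro x y hxy
    apply ofRatClass_injective k
    apply hC.1
    rw [← D.ofRatClass_lefschetzPow, ← D.ofRatClass_lefschetzPow, hxy]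
  · intro w
    obtain ⟨c, hc⟩ := hC.2 (ofRatClass _ _ w)
    have hcQ : IsRationalClass c :=
      isRationalClass_of_lefschetzPow_of_hasHardLefschetzProperty hX D.isRationalClass_Hη
        (D.hasHardLefschetzProperty hX) j k hkj c (by rw [hc]; exact isRationalClass_ofRatClass _)
    obtain ⟨v, rfl⟩ := (isRationalClass_iff_mem_range_ofRatClass _).1 hcQ
    refine ⟨v, ofRatClass_injective (k + 2 * j) ?_⟩
    rw [D.ofRatClass_lefschetzPow, hc]

/-- `η ⊗ 1` is of Hodge type `(1, 1)`. [cite: VoisinHodgeI2002, §3.1.1 Lemma 3.3 and §7.1.2] -/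
theorem isOfHodgeType_Hη : IsOfHodgeType n X 2 1 1 D.Hη :=
  D.isKaehlerClassVia.isOfHodgeType_one_one D.isNatural

/-- The cup product preserves Hodge types on `X` (from de Rham's theorem for `B.model`).
[cite: VoisinHodgeI2002, §7.1.2] -/
theorem _root_.Literature.AlgebraicGeometry.HodgeTheory.cupPreservesHodgeType_of_hodgeModel
    (hX : Motives.IsSmoothProjective n X) (B : HodgeModel n X) : CupPreservesHodgeType n X :=
  cupPreservesHodgeType_of_exists_deRhamIsoFamily hodgePQ_independent_of_hodgeModel_holds hX B
    (Literature.NumberTheory.Transcendental.exists_deRhamIsoFamily_holds B.model)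

/-- **`L_{η ⊗ 1}` raises Hodge types by `(1, 1)`**, read in ANY Hodge model `A` (cup product
preserves types, `η ⊗ 1` of type `(1,1)`, independence of the model). [cite: VoisinHodgeI2002, Rem. 6.27 and §7.1.2] -/
theorem lefschetzOperator_mem_typePiece (hX : Motives.IsSmoothProjective n X) (A : HodgeModel n X) :
    ∀ (k l : ℕ) (hkl : 2 + k = l) (pq : ↥(Finset.HasAntidiagonal.antidiagonal k)) (c : complexBetti X k),
      c ∈ A.typePiece k pq → lefschetzOperator D.Hη hkl c ∈ A.typePiece l (HodgeModel.typeShift hkl pq) := by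
  intro k l hkl pq c hc
  have h := isOfHodgeType_lefschetzOperator_of_cupPreservesHodgeType
    (cupPreservesHodgeType_of_hodgeModel hX D.B) D.isOfHodgeType_Hη k l hkl pq.1.1 pq.1.2 c
    (A.isOfHodgeType_of_mem_typePiece hc)
  exact A.mem_typePiece_of_isOfHodgeType hodgePQ_independent_of_hodgeModel_holds hX _ h

/-- Conjugation commutes with `L_{η ⊗ 1}` (the form fed to `map_primitivePart_of_commute`). [folklore] -/
theorem conjClassHom_commute :
    ∀ (k l : ℕ) (h : 2 + k = l) (x : singularCohomology ℂ ℂ (Motives.ComplexPoints X) k),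
      conjClassHom _ l (lefschetzOperator D.Hη h x) = lefschetzOperator D.Hη h (conjClassHom _ k x) :=
  conjClass_lefschetzOperator D.conjClass_Hη

/-- The diagonal type projectors of any model commute with `L_{η ⊗ 1}` (the form fed to
`map_primitivePart_of_commute`). [cite: VoisinHodgeI2002, Rem. 6.27] -/
theorem typeProjDiff_commute (hX : Motives.IsSmoothProjective n X) (A : HodgeModel n X) (δ : ℤ) :
    ∀ (k l : ℕ) (h : 2 + k = l) (x : singularCohomology ℂ ℂ (Motives.ComplexPoints X) k),
      (A.typeProjDiff l δ).toAddMonoidHom (lefschetzOperator D.Hη h x) =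
        lefschetzOperator D.Hη h ((A.typeProjDiff k δ).toAddMonoidHom x) :=
  fun _ _ h x ↦ A.lefschetzOperator_typeProjDiff (D.lefschetzOperator_mem_typePiece hX A) h δ x

end KaehlerRationalDatum

/-! ### Lines: the coordinate functional along a non-zero vector -/

/-- The **coordinate functional** along a non-zero vector `v` of a line `V` (`dim V = 1`): the linear
form `λ` with `λ(c • v) = c` (the coordinate of the basis `{v}`). [folklore] -/
def lineCoord {K V : Type*} [Field K] [AddCommGroup V] [Module K V] (v : V) (hv : v ≠ 0)
    (h1 : Module.finrank K V = 1) : V →ₗ[K] K :=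
  (FiniteDimensional.basisSingleton Unit h1 v hv).coord default

/-- `λ(v) = 1`. [folklore] -/
theorem lineCoord_self {K V : Type*} [Field K] [AddCommGroup V] [Module K V] (v : V) (hv : v ≠ 0)
    (h1 : Module.finrank K V = 1) : lineCoord v hv h1 v = 1 := by
  unfold lineCoord
  have h : (FiniteDimensional.basisSingleton Unit h1 v hv).coord default ((FiniteDimensional.basisSingleton Unit h1 v hv) default) = 1 := by
    rw [Basis.coord_apply, Basis.repr_self, Finsupp.single_eq_same]
  rwa [FiniteDimensional.basisSingleton_apply] at h

/-- `λ(c • v) = c`. [folklore] -/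
theorem lineCoord_apply_smul {K V : Type*} [Field K] [AddCommGroup V] [Module K V] (v : V) (hv : v ≠ 0)
    (h1 : Module.finrank K V = 1) (c : K) : lineCoord v hv h1 (c • v) = c := by
  rw [LinearMap.map_smul, lineCoord_self, smul_eq_mul, mul_one]

/-- `λ(w) • v = w`: every vector of the line is its coordinate times `v`. [folklore] -/
theorem lineCoord_smul_self {K V : Type*} [Field K] [AddCommGroup V] [Module K V] (v : V) (hv : v ≠ 0)
    (h1 : Module.finrank K V = 1) (w : V) : lineCoord v hv h1 w • v = w := by
  obtain ⟨c, rfl⟩ := (finrank_eq_one_iff_of_nonzero' v hv).1 h1 w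
  rw [lineCoord_apply_smul]

/-! ### The top degree `H^{2n}(X(ℂ))`: a rational generator, the rational and complex coordinates -/

/-- `dim_ℚ H^{2n}(X(ℂ); ℚ) = 1` (universal coefficients `ℂ ⊗_ℚ H^{2n}(X(ℂ); ℚ) ≅ H^{2n}(X(ℂ); ℂ)`,
`ofRatClassBaseChange` bijective, and `dim_ℂ H^{2n}(X(ℂ); ℂ) = 1`). [cite: HatcherAT2002, §3.3 Cor. 3.37] -/
theorem finrank_rat_top (hX : Motives.IsSmoothProjective n X) :
    Module.finrank ℚ (singularCohomology ℚ ℚ (Motives.ComplexPoints X) (2 * n)) = 1 := by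
  haveI := finite_singularCohomology_rat_complexPoints hX (2 * n)
  have h := (LinearEquiv.ofBijective (ofRatClassBaseChange (Motives.ComplexPoints X) (2 * n))
    ⟨ofRatClassBaseChange_injective _ (2 * n), ofRatClassBaseChange_surjective hX (2 * n)⟩).finrank_eq
  rw [Module.finrank_baseChange] at h
  rw [h]
  exact finrank_complexBetti_two_mul_eq_one hX

/-- There is a non-zero rational class in the top degree. [folklore] -/
theorem exists_ratTop_ne_zero (hX : Motives.IsSmoothProjective n X) :
    ∃ v : singularCohomology ℚ ℚ (Motives.ComplexPoints X) (2 * n), v ≠ 0 := by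
  haveI := finite_singularCohomology_rat_complexPoints hX (2 * n)
  exact Module.finrank_pos_iff_exists_ne_zero.1 (by rw [finrank_rat_top hX]; exact one_pos)

/-- A chosen **non-zero rational top class** `v₀ ∈ H^{2n}(X(ℂ); ℚ)`. [folklore] -/
def ratTopVec (hX : Motives.IsSmoothProjective n X) : singularCohomology ℚ ℚ (Motives.ComplexPoints X) (2 * n) :=
  (exists_ratTop_ne_zero hX).choose

/-- `v₀ ≠ 0`. [folklore] -/
theorem ratTopVec_ne_zero (hX : Motives.IsSmoothProjective n X) : ratTopVec hX ≠ 0 :=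
  (exists_ratTop_ne_zero hX).choose_spec

/-- `v₀ ⊗ 1 ≠ 0`. [folklore] -/
theorem ofRatClass_ratTopVec_ne_zero (hX : Motives.IsSmoothProjective n X) :
    ofRatClass (Motives.ComplexPoints X) (2 * n) (ratTopVec hX) ≠ 0 := fun h ↦
  ratTopVec_ne_zero hX (ofRatClass_injective (2 * n) (by rw [h, map_zero]))

/-- The **rational coordinate** `H^{2n}(X(ℂ); ℚ) → ℚ` along `v₀`. [folklore] -/
def ratTopCoord (hX : Motives.IsSmoothProjective n X) :
    singularCohomology ℚ ℚ (Motives.ComplexPoints X) (2 * n) →ₗ[ℚ] ℚ :=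
  lineCoord (ratTopVec hX) (ratTopVec_ne_zero hX) (finrank_rat_top hX)

/-- The **complex coordinate** `H^{2n}(X(ℂ); ℂ) → ℂ` along `v₀ ⊗ 1`. [folklore] -/
def cTopCoord (hX : Motives.IsSmoothProjective n X) : complexBetti X (2 * n) →ₗ[ℂ] ℂ :=
  lineCoord (ofRatClass (Motives.ComplexPoints X) (2 * n) (ratTopVec hX)) (ofRatClass_ratTopVec_ne_zero hX)
    (finrank_complexBetti_two_mul_eq_one hX)

/-- `λ_ℂ(z) • (v₀ ⊗ 1) = z` on the complex line `H^{2n}(X(ℂ); ℂ)`. [folklore] -/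
theorem cTopCoord_smul_self (hX : Motives.IsSmoothProjective n X) (z : complexBetti X (2 * n)) :
    cTopCoord hX z • ofRatClass (Motives.ComplexPoints X) (2 * n) (ratTopVec hX) = z :=
  lineCoord_smul_self _ _ _ z

/-- **The complex coordinate extends the rational one**: `λ_ℂ(z ⊗ 1) = λ_ℚ(z)`. [folklore] -/
theorem cTopCoord_ofRatClass (hX : Motives.IsSmoothProjective n X)
    (z : singularCohomology ℚ ℚ (Motives.ComplexPoints X) (2 * n)) :
    cTopCoord hX (ofRatClass _ (2 * n) z) = algebraMap ℚ ℂ (ratTopCoord hX z) := by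
  conv_lhs => rw [← lineCoord_smul_self (ratTopVec hX) (ratTopVec_ne_zero hX) (finrank_rat_top hX) z]
  rw [Literature.AlgebraicGeometry.Motives.ofRatClass_smul, cTopCoord, lineCoord_apply_smul]
  rfl

namespace KaehlerRationalDatum

variable (D : KaehlerRationalDatum n X)

/-! ### The fundamental class `[ω_gⁿ]` and the sign of its coordinate -/

/-- The **top Kähler class** on `X(ℂ)`: the class `Ω ∈ H^{2n}(X(ℂ); ℂ)` with
`B^* Ω = e[ω_gⁿ] ⊗ 1` (the right-hand side of `hodgeRiemann_primitiveClass`, transported along the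
bijective comparison). [cite: VoisinHodgeI2002, §3.1.3 Cor. 3.9] -/
def topClass : complexBetti X (2 * n) :=
  (D.B.pullbackEquiv (2 * n)).symm (ofRealClass D.B.carrier (2 * n) (D.e D.B.carrier (2 * n)
    (deRhamCohomology.mk ⟨kaehlerFormPow D.g.toRiemannianMetric n,
      D.B.kaehlerFormPow_mem_closedSmoothForms D.g D.isKaehler n⟩)))

/-- `B^* Ω = e[ω_gⁿ] ⊗ 1`. [folklore] -/
theorem pullback_topClass : D.B.pullback (2 * n) D.topClass =
    ofRealClass D.B.carrier (2 * n) (D.e D.B.carrier (2 * n)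
      (deRhamCohomology.mk ⟨kaehlerFormPow D.g.toRiemannianMetric n,
        D.B.kaehlerFormPow_mem_closedSmoothForms D.g D.isKaehler n⟩)) := by
  rw [topClass, ← HodgeModel.pullbackEquiv_apply, LinearEquiv.apply_symm_apply]

/-- `Ω ≠ 0` (`[ω_gⁿ] ≠ 0` on the compact Kähler `X^an`, Voisin I Cor. 3.9). [cite: VoisinHodgeI2002, §3.1.3 Cor. 3.9] -/
theorem topClass_ne_zero (hX : Motives.IsSmoothProjective n X) : D.topClass ≠ 0 := by
  haveI : Nonempty D.B.carrier := D.B.nonempty_carrier hX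
  haveI : CompactSpace D.B.carrier := by
    haveI := Motives.ComplexPoints.compactSpace_of_isSmoothProjective hX
    exact D.B.isAnalytification.homeomorph.symm.compactSpace
  have hne := Literature.AlgebraicGeometry.Motives.kaehlerFormPow_deRhamCohomology_mk_ne_zero D.g
    D.isKaehler (k := n) (by rw [D.B.isAnalytification.finrank_eq])
    (D.B.kaehlerFormPow_mem_closedSmoothForms D.g D.isKaehler n)
  intro h0
  apply hne
  have h1 := D.pullback_topClass
  rw [h0, map_zero] at h1
  exact (LinearEquiv.map_eq_zero_iff _).1 (ofRealClass_injective (2 * n) (by rw [← h1, map_zero]))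

/-- `Ω` is real: `conj Ω = Ω`. [cite: VoisinHodgeI2002, Cor. 6.12] -/
theorem conjClass_topClass : conjClass (Motives.ComplexPoints X) (2 * n) D.topClass = D.topClass := by
  apply D.B.pullback_injective (2 * n)
  change singularCohomology.map ℂ ℂ _ (2 * n) (conjClass _ (2 * n) D.topClass) = _
  rw [← conjClass_map]
  change conjClass D.B.carrier (2 * n) (D.B.pullback (2 * n) D.topClass) = D.B.pullback (2 * n) D.topClass
  rw [D.pullback_topClass, conjClass_ofRealClass]

/-- The complex coordinate of `Ω` along `v₀ ⊗ 1` is REAL (both classes are fixed by conjugation).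
[cite: VoisinHodgeI2002, Cor. 6.12] -/
theorem im_cTopCoord_topClass (hX : Motives.IsSmoothProjective n X) : (cTopCoord hX D.topClass).im = 0 := by
  have h := cTopCoord_smul_self hX D.topClass
  have hc : (starRingEnd ℂ) (cTopCoord hX D.topClass) •
      ofRatClass (Motives.ComplexPoints X) (2 * n) (ratTopVec hX) = D.topClass := by
    conv_rhs => rw [← D.conjClass_topClass, ← h]
    rw [conjClass_smul, conjClass_ofRatClass]
  have hsub : ((starRingEnd ℂ) (cTopCoord hX D.topClass) - cTopCoord hX D.topClass) •
      ofRatClass (Motives.ComplexPoints X) (2 * n) (ratTopVec hX) = 0 := by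
    rw [sub_smul, hc, h, sub_self]
  have heq := (smul_eq_zero.1 hsub).resolve_right (ofRatClass_ratTopVec_ne_zero hX)
  exact Complex.conj_eq_iff_im.1 (sub_eq_zero.1 heq)

/-- The complex coordinate of `Ω` is non-zero. [folklore] -/
theorem cTopCoord_topClass_ne_zero (hX : Motives.IsSmoothProjective n X) : cTopCoord hX D.topClass ≠ 0 := by
  intro h0
  have h := cTopCoord_smul_self hX D.topClass
  rw [h0, zero_smul] at h
  exact D.topClass_ne_zero hX h.symm

/-- The **sign** `ε = ±1` making the coordinate of `Ω` positive. [folklore] -/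
def traceSign (hX : Motives.IsSmoothProjective n X) : ℚ :=
  if 0 < (cTopCoord hX D.topClass).re then 1 else -1

/-- The normalised **rational trace** `τ_ℚ = ε λ_ℚ : H^{2n}(X(ℂ); ℚ) → ℚ`. [cite: VoisinHodgeI2002, §7.1.2] -/
def ratTrace (hX : Motives.IsSmoothProjective n X) :
    singularCohomology ℚ ℚ (Motives.ComplexPoints X) (2 * n) →ₗ[ℚ] ℚ :=
  D.traceSign hX • ratTopCoord hX

/-- The normalised **complex trace** `τ_ℂ = ε λ_ℂ : H^{2n}(X(ℂ); ℂ) → ℂ`. [cite: VoisinHodgeI2002, §7.1.2] -/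
def cTrace (hX : Motives.IsSmoothProjective n X) : complexBetti X (2 * n) →ₗ[ℂ] ℂ :=
  (algebraMap ℚ ℂ (D.traceSign hX)) • cTopCoord hX

/-- `τ_ℂ` extends `τ_ℚ`: `τ_ℂ(z ⊗ 1) = τ_ℚ(z)` (the compatibility fed to `map_polarizationForm_of_eq`). [folklore] -/
theorem cTrace_ofRatClass (hX : Motives.IsSmoothProjective n X)
    (z : singularCohomology ℚ ℚ (Motives.ComplexPoints X) (2 * n)) :
    D.cTrace hX (singularCohomology.ringChange (algebraMap ℚ ℂ) (Motives.ComplexPoints X) (2 * n) z) =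
      algebraMap ℚ ℂ (D.ratTrace hX z) := by
  rw [← ofRatClass_eq_ringChange, cTrace, ratTrace, LinearMap.smul_apply, LinearMap.smul_apply,
    cTopCoord_ofRatClass, smul_eq_mul, smul_eq_mul, map_mul]

/-- **`τ_ℂ(Ω)` is a positive real.** [cite: VoisinHodgeI2002, §7.1.2] -/
theorem cTrace_topClass_pos (hX : Motives.IsSmoothProjective n X) :
    0 < (D.cTrace hX D.topClass).re ∧ (D.cTrace hX D.topClass).im = 0 := by
  have him := D.im_cTopCoord_topClass hX
  have hne := D.cTopCoord_topClass_ne_zero hX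
  have hre : (cTopCoord hX D.topClass).re ≠ 0 := fun h ↦ hne (Complex.ext h him)
  unfold cTrace traceSign
  split_ifs with hpos
  · simp [him, hpos]
  · refine ⟨?_, by simp [him]⟩
    simp only [map_neg, map_one, neg_smul, one_smul]
    push Not at hpos
    exact neg_pos.2 (lt_of_le_of_ne hpos hre)

end KaehlerRationalDatum

namespace KaehlerRationalDatum

variable (D : KaehlerRationalDatum n X)

/-! ### Hodge types of the primitive parts for `L_{η ⊗ 1}` -/

/-- The hard-Lefschetz witness and the vanishing witness consumed by the Lefschetz-decomposition
files, over `ℂ`. [folklore] -/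
abbrev hLℂ (hX : Motives.IsSmoothProjective n X) := D.hasHardLefschetzProperty hX

/-- **The primitive part of a class of pure type is of pure type** (Voisin I §7.1.2: the Lefschetz
decomposition is compatible with the Hodge decomposition): if `x ∈ Hᵏ(X(ℂ); ℂ)` has `A`-type `(p, q)`
then its primitive part of index `(a, t)` has `A`-type `(s, t')` for the pair `s + t' = a`,
`s - t' = p - q` (i.e. `(p - t, q - t)`). From `map_primitivePart_of_commute` for the diagonal
projectors `T^{p-q}` (`typeProjDiff_commute`). [cite: VoisinHodgeI2002, §6.2.3 Rem. 6.27 and §7.1.2] -/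
theorem primitivePart_mem_typePiece (hX : Motives.IsSmoothProjective n X) (A : HodgeModel n X) {k : ℕ}
    {pq : ↥(Finset.HasAntidiagonal.antidiagonal k)} {x : complexBetti X k} (hx : x ∈ A.typePiece k pq)
    (P : {p : ℕ × ℕ // p.1 + 2 * p.2 = k}) (st : ↥(Finset.HasAntidiagonal.antidiagonal P.1.1))
    (hst : (st.1.1 : ℤ) - st.1.2 = (pq.1.1 : ℤ) - pq.1.2) :
    primitivePart D.Hη n (D.hLℂ hX) (subsingleton_of_lt hX ℂ) P x ∈ A.typePiece P.1.1 st := by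
  have h := map_primitivePart_of_commute (D.hLℂ hX) (subsingleton_of_lt hX ℂ)
    (fun a ↦ (A.typeProjDiff a ((pq.1.1 : ℤ) - pq.1.2)).toAddMonoidHom)
    (D.typeProjDiff_commute hX A ((pq.1.1 : ℤ) - pq.1.2)) P x
  simp only [LinearMap.toAddMonoidHom_coe] at h
  rw [A.typeProjDiff_apply_of_mem hx] at h
  rw [← h]
  exact A.typeProjDiff_mem st hst _

/-- If no pair `(s, t')` with `s + t' = a`, `s - t' = p - q` exists (i.e. `t > p` or `t > q`), the
primitive part of index `(a, t)` of a class of type `(p, q)` vanishes. [cite: VoisinHodgeI2002, §7.1.2] -/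
theorem primitivePart_eq_zero_of_no_type (hX : Motives.IsSmoothProjective n X) (A : HodgeModel n X) {k : ℕ}
    {pq : ↥(Finset.HasAntidiagonal.antidiagonal k)} {x : complexBetti X k} (hx : x ∈ A.typePiece k pq)
    (P : {p : ℕ × ℕ // p.1 + 2 * p.2 = k})
    (hno : ∀ st : ↥(Finset.HasAntidiagonal.antidiagonal P.1.1), (st.1.1 : ℤ) - st.1.2 ≠ (pq.1.1 : ℤ) - pq.1.2) :
    primitivePart D.Hη n (D.hLℂ hX) (subsingleton_of_lt hX ℂ) P x = 0 := by
  have h := map_primitivePart_of_commute (D.hLℂ hX) (subsingleton_of_lt hX ℂ)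
    (fun a ↦ (A.typeProjDiff a ((pq.1.1 : ℤ) - pq.1.2)).toAddMonoidHom)
    (D.typeProjDiff_commute hX A ((pq.1.1 : ℤ) - pq.1.2)) P x
  simp only [LinearMap.toAddMonoidHom_coe] at h
  rw [A.typeProjDiff_apply_of_mem hx, A.typeProjDiff_eq_zero hno, LinearMap.zero_apply] at h
  exact h.symm

/-- Conjugation commutes with the primitive parts for `L_{η ⊗ 1}`. [cite: VoisinHodgeI2002, §7.1.2] -/
theorem conjClass_primitivePart (hX : Motives.IsSmoothProjective n X) {k : ℕ}
    (P : {p : ℕ × ℕ // p.1 + 2 * p.2 = k}) (x : complexBetti X k) :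
    conjClass _ P.1.1 (primitivePart D.Hη n (D.hLℂ hX) (subsingleton_of_lt hX ℂ) P x) =
      primitivePart D.Hη n (D.hLℂ hX) (subsingleton_of_lt hX ℂ) P (conjClass _ k x) := by
  have h := map_primitivePart_of_commute (D.hLℂ hX) (subsingleton_of_lt hX ℂ)
    (conjClassHom (Motives.ComplexPoints X)) D.conjClassHom_commute P x
  simpa only [conjClassHom_apply] using h

/-! ### The Hodge filtration and the type projectors -/

/-- **Classes in `Fʳ` have no components of type `(p, q)` with `p < r`**: if `A^* c ∈ Fʳ Hᵏ(X^an)`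
(`HodgeModel.hodgeFiltration`, `Fʳ = ⨁_{p ≥ r} H^{p,q}`) then `π_{(p,q)} c = 0` for `p < r`.
[cite: VoisinHodgeI2002, §7.1.1 Def. 7.4] -/
theorem _root_.Literature.AlgebraicGeometry.HodgeTheory.HodgeModel.typeProj_eq_zero_of_mem_hodgeFiltration
    (A : HodgeModel n X) {k r : ℕ} {c : complexBetti X k} (hc : A.pullback k c ∈ A.hodgeFiltration k r)
    (pq : ↥(Finset.HasAntidiagonal.antidiagonal k)) (hpq : pq.1.1 < r) : A.typeProj k pq c = 0 := by
  -- the subspace of `Hᵏ(X^an)` whose preimage has no low-type components contains `Fʳ`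
  let S : Submodule ℂ (singularCohomology ℂ ℂ A.carrier k) :=
    ⨅ (pq : ↥(Finset.HasAntidiagonal.antidiagonal k)) (_ : pq.1.1 < r),
      LinearMap.ker (A.typeProj k pq ∘ₗ (A.pullbackEquiv k).symm.toLinearMap)
  have hle : A.hodgeFiltration k r ≤ S := by
    refine iSup_le fun p ↦ iSup_le fun q ↦ iSup_le fun hpq' ↦ iSup_le fun hrp ↦ ?_
    intro c' hc'
    simp only [S, Submodule.mem_iInf, LinearMap.mem_ker, LinearMap.comp_apply]
    intro pq' hlt
    have hmem : (A.pullbackEquiv k).symm c' ∈ A.typePiece k ⟨(p, q), Finset.HasAntidiagonal.mem_antidiagonal.2 hpq'⟩ := by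
      rw [HodgeModel.mem_typePiece_iff, ← HodgeModel.pullbackEquiv_apply, LinearEquiv.apply_symm_apply]
      exact hc'
    refine A.typeProj_apply_of_mem_ne (fun h ↦ ?_) hmem
    have h' := congrArg (fun i : ↥(Finset.HasAntidiagonal.antidiagonal k) ↦ i.1.1) h
    simp only at h'
    omega
  have hS := hle hc
  simp only [S, Submodule.mem_iInf, LinearMap.mem_ker, LinearMap.comp_apply] at hS
  have h := hS pq hpq
  rwa [LinearEquiv.coe_coe, ← HodgeModel.pullbackEquiv_apply, LinearEquiv.symm_apply_apply] at h

/-! ### The Hodge–Riemann relation on `X(ℂ)` -/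

/-- **Hodge–Riemann for a primitive `(s, t')`-class on `X(ℂ)`** (Voisin I Thm. 6.32, transported from
`X^an` along the comparison of the datum): for `ξ ∈ Hᵃ(X(ℂ); ℂ)` of Hodge type `(s, t')`, non-zero,
`a + r₀ = n`, with `L^{r₀+1}_{η ⊗ 1} ξ = 0`, the class `i^{s-t'} (-1)^{a(a-1)/2} (L^{r₀} ξ ∪ ξ̄)` is a
POSITIVE real multiple of the top Kähler class `Ω` (`hodgeRiemann_primitiveClass` on `X^an` for the
model `B` with comparison `e ⊗ ℂ`, pulled back along the bijective multiplicative `B^*`).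
[cite: VoisinHodgeI2002, §6.3.2 Thm. 6.32] -/
theorem hodgeRiemann_X (hX : Motives.IsSmoothProjective n X) {a s t' r₀ : ℕ}
    (har : a + r₀ = n) (h2 : (a + 2 * r₀) + a = 2 * n) {ξ : complexBetti X a}
    (hξ : IsOfHodgeType n X a s t' ξ) (hξ0 : ξ ≠ 0) (hprim : lefschetzPow D.Hη (r₀ + 1) a ξ = 0) :
    ∃ t : ℝ, 0 < t ∧
      (Complex.I ^ ((s : ℤ) - t') * (-1) ^ (a * (a - 1) / 2)) •
          cupProduct h2 (lefschetzPow D.Hη r₀ a ξ) (conjClass _ a ξ) = (t : ℂ) • D.topClass := by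
  -- the model `B'` with comparison `e ⊗ ℂ` and the instances on `X^an`
  let B' : HodgeModel n X :=
    { D.B with
      deRham := D.e.complexify
      deRham_isNatural := DeRhamIsoFamily.complexify_isNatural D.isNatural }
  haveI : CompactSpace D.B.carrier := by
    haveI := Motives.ComplexPoints.compactSpace_of_isSmoothProjective hX
    exact D.B.isAnalytification.homeomorph.symm.compactSpace
  haveI : ConnectedSpace D.B.carrier := D.B.connectedSpace_carrier hX
  -- `ξ` read in `B'`: `B^* ξ = (e ⊗ ℂ) c` with `c ∈ H^{s,t'}`
  have hξ' : B'.pullback a ξ ∈ B'.hodgePQ a s t' :=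
    (hodgePQ_independent_of_hodgeModel.isOfHodgeType_iff hodgePQ_independent_of_hodgeModel_holds hX B').1 hξ
  change D.B.pullback a ξ ∈ (hodgePQ D.B.model D.B.carrier a s t').map
    (D.e.complexifyEquiv D.B.carrier a).toLinearMap at hξ'
  obtain ⟨c, hc, hcξ⟩ := Submodule.mem_map.1 hξ'
  rw [LinearEquiv.coe_toLinearMap, complexifyEquiv_apply] at hcξ
  -- the comparison map and the singular Kähler class on `X^an`
  set f : C(D.B.carrier, Motives.ComplexPoints X) :=
    ⟨D.B.toComplexPoints, D.B.isAnalytification.isHomeomorph.continuous⟩ with hf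
  have hκ : singularCohomology.map ℂ ℂ f 2 D.Hη =
      ofRealClass D.B.carrier 2 (D.e D.B.carrier 2 (D.g.kaehlerClass D.hω D.isKaehler)) := D.pullback_eq
  have hc0 : c ≠ 0 := by
    rintro rfl
    apply hξ0
    apply D.B.pullback_injective a
    rw [map_zero, ← hcξ]
    exact (D.e.complexifyEquiv D.B.carrier a).map_zero
  have hprimM : lefschetzPow (ofRealClass D.B.carrier 2 (D.e D.B.carrier 2 (D.g.kaehlerClass D.hω D.isKaehler)))
      (r₀ + 1) a (complexifyFun D.e a c) = 0 := by
    rw [hcξ, ← hκ]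
    change lefschetzPow _ (r₀ + 1) a (singularCohomology.map ℂ ℂ f a ξ) = 0
    rw [← lefschetzPow_map, hprim, map_zero]
  have htop : Module.finrank ℂ (singularCohomology ℂ ℂ D.B.carrier (2 * n)) = 1 := by
    rw [← (D.B.pullbackEquiv (2 * n)).finrank_eq]
    exact finrank_complexBetti_two_mul_eq_one hX
  obtain ⟨t, ht, heq⟩ := hodgeRiemann_primitiveClass D.isMultiplicative D.hω D.g D.isKaehler
    D.B.isAnalytification.finrank_eq htop har h2 hc hc0 hprimM
  refine ⟨t, ht, D.B.pullback_injective (2 * n) ?_⟩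
  rw [_root_.map_smul, _root_.map_smul, D.pullback_topClass]
  change _ • singularCohomology.map ℂ ℂ f (2 * n) (cupProduct h2 _ _) = _
  rw [cupProduct_map, lefschetzPow_map, hκ, ← conjClass_map]
  change _ • cupProduct h2 (lefschetzPow _ r₀ a (D.B.pullback a ξ)) (conjClass _ a (D.B.pullback a ξ)) = _
  rw [← hcξ, heq]

end KaehlerRationalDatum

namespace KaehlerRationalDatum

variable (D : KaehlerRationalDatum n X)

/-! ### The polarisation form over `ℚ` and its complexification -/

/-- The hard-Lefschetz witness over `ℚ`. [folklore] -/
abbrev hLℚ (hX : Motives.IsSmoothProjective n X) := D.hasHardLefschetzProperty_rat hX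

/-- **The polarisation form** `Q` on `Hᵏ(X(ℂ); ℚ)` of the datum: the form of the Lefschetz
decomposition of the rational Kähler class `η` with the normalised trace `τ_ℚ`
(`polarizationForm`; Voisin I §7.1.2). [cite: VoisinHodgeI2002, §6.3.2 and §7.1.2] -/
def form (hX : Motives.IsSmoothProjective n X) (k : ℕ) :
    LinearMap.BilinForm ℚ (singularCohomology ℚ ℚ (Motives.ComplexPoints X) k) :=
  polarizationForm D.η n (D.hLℚ hX) (subsingleton_of_lt hX ℚ) (D.ratTrace hX) k

/-- The same form over `ℂ` on `Hᵏ(X(ℂ); ℂ)` (for `η ⊗ 1` and `τ_ℂ`). [cite: VoisinHodgeI2002, §7.1.2] -/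
def cform (hX : Motives.IsSmoothProjective n X) (k : ℕ) : LinearMap.BilinForm ℂ (complexBetti X k) :=
  polarizationForm D.Hη n (D.hLℂ hX) (subsingleton_of_lt hX ℂ) (D.cTrace hX) k

/-- **`Q ⊗ ℂ` is `Q_ℂ` on rational classes**: `Q(v, w) = Q_ℂ(v ⊗ 1, w ⊗ 1)`
(`map_polarizationForm_of_eq` for `ℚ ⊆ ℂ`). [cite: VoisinHodgeI2002, §7.1.2] -/
theorem algebraMap_form (hX : Motives.IsSmoothProjective n X) {k : ℕ}
    (v w : singularCohomology ℚ ℚ (Motives.ComplexPoints X) k) :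
    algebraMap ℚ ℂ (D.form hX k v w) = D.cform hX k (ofRatClass _ k v) (ofRatClass _ k w) := by
  rw [form, cform, ofRatClass_eq_ringChange, ofRatClass_eq_ringChange]
  exact map_polarizationForm_of_eq (D.hLℚ hX) (subsingleton_of_lt hX ℚ) (algebraMap ℚ ℂ) D.ringChange_eq
    (D.hLℂ hX) (subsingleton_of_lt hX ℂ) (D.ratTrace hX) (D.cTrace hX) (D.cTrace_ofRatClass hX) v w

/-- **The base change of `Q` to `ℂ ⊗_ℚ Hᵏ(X(ℂ); ℚ)` is `Q_ℂ` after `ofRatClassBaseChange`.**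
[cite: VoisinHodgeI2002, §7.1.2] -/
theorem form_baseChange (hX : Motives.IsSmoothProjective n X) {k : ℕ}
    (x y : ℂ ⊗[ℚ] singularCohomology ℚ ℚ (Motives.ComplexPoints X) k) :
    (D.form hX k).baseChange ℂ x y =
      D.cform hX k (ofRatClassBaseChange _ k x) (ofRatClassBaseChange _ k y) := by
  induction x using TensorProduct.induction_on with
  | zero => rw [map_zero, LinearMap.zero_apply, map_zero, map_zero, LinearMap.zero_apply]
  | add x x' hx hx' => rw [map_add, LinearMap.add_apply, hx, hx', map_add, map_add, LinearMap.add_apply]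
  | tmul a v =>
    induction y using TensorProduct.induction_on with
    | zero => rw [map_zero, map_zero, map_zero]
    | add y y' hy hy' => rw [map_add, hy, hy', map_add, map_add]
    | tmul b w =>
      rw [LinearMap.BilinForm.baseChange_tmul, ofRatClassBaseChange_tmul, ofRatClassBaseChange_tmul,
        LinearMap.map_smul₂, LinearMap.map_smul, ← D.algebraMap_form hX, Algebra.smul_def, smul_eq_mul,
        smul_eq_mul]
      ring

/-! ### The Hodge–Riemann terms -/

/-- **The Hodge–Riemann term of a Lefschetz component is a non-negative multiple of `τ_ℂ(Ω)`,
positive when the component is non-zero**: for `x` of `A`-type `(p, q)` and a Lefschetz index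
`P = (a, t)`, `i^{p-q} B_a(ξ_P x, conj(ξ_P x)) = t_P · τ_ℂ(Ω)` with `t_P ≥ 0`, and `t_P > 0` if
`ξ_P x ≠ 0` (then `ξ_P x` is a non-zero primitive class of type `(p - t, q - t)` and
`hodgeRiemann_X` applies; `i^{p-q} = i^{(p-t)-(q-t)}`). [cite: VoisinHodgeI2002, §6.3.2 Thm. 6.32 and §7.1.2] -/
theorem hodgeRiemannPairing_primitivePart (hX : Motives.IsSmoothProjective n X) (A : HodgeModel n X)
    {k : ℕ} {pq : ↥(Finset.HasAntidiagonal.antidiagonal k)} {x : complexBetti X k}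
    (hx : x ∈ A.typePiece k pq) (P : {p : ℕ × ℕ // p.1 + 2 * p.2 = k}) :
    ∃ t : ℝ, 0 ≤ t ∧ (primitivePart D.Hη n (D.hLℂ hX) (subsingleton_of_lt hX ℂ) P x ≠ 0 → 0 < t) ∧
      Complex.I ^ ((pq.1.1 : ℤ) - pq.1.2) *
          hodgeRiemannPairing D.Hη n (D.cTrace hX) P.1.1
            (primitivePart D.Hη n (D.hLℂ hX) (subsingleton_of_lt hX ℂ) P x)
            (conjClass _ P.1.1 (primitivePart D.Hη n (D.hLℂ hX) (subsingleton_of_lt hX ℂ) P x)) =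
        t * D.cTrace hX D.topClass := by
  set ξ := primitivePart D.Hη n (D.hLℂ hX) (subsingleton_of_lt hX ℂ) P x with hξdef
  by_cases hξ0 : ξ = 0
  · refine ⟨0, le_rfl, fun h ↦ absurd hξ0 h, ?_⟩
    rw [hξ0, LinearMap.map_zero, LinearMap.zero_apply, mul_zero, Complex.ofReal_zero, zero_mul]
  have hpq := Finset.HasAntidiagonal.mem_antidiagonal.1 pq.2
  have hP2 := P.2
  -- `a + t ≤ n`, else `ξ = 0`
  rcases le_or_gt (P.1.1 + P.1.2) n with hP | hP
  swap
  · exact absurd (by rw [hξdef, primitivePart_of_lt _ _ P hP, LinearMap.zero_apply]) hξ0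
  -- the type `(p - t, q - t)` exists, else `ξ = 0`
  by_cases hty : P.1.2 ≤ pq.1.1 ∧ P.1.2 ≤ pq.1.2
  swap
  · refine absurd (D.primitivePart_eq_zero_of_no_type hX A hx P fun st h ↦ hty ?_) hξ0
    have h1 := Finset.HasAntidiagonal.mem_antidiagonal.1 st.2
    constructor <;> omega
  obtain ⟨ht1, ht2⟩ := hty
  let st : ↥(Finset.HasAntidiagonal.antidiagonal P.1.1) :=
    ⟨(pq.1.1 - P.1.2, pq.1.2 - P.1.2), Finset.HasAntidiagonal.mem_antidiagonal.2 (by simp only; omega)⟩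
  have hst : (st.1.1 : ℤ) - st.1.2 = (pq.1.1 : ℤ) - pq.1.2 := by
    simp only [st]; push_cast [ht1, ht2]; ring
  have hξT : IsOfHodgeType n X P.1.1 st.1.1 st.1.2 ξ :=
    A.isOfHodgeType_of_mem_typePiece (D.primitivePart_mem_typePiece hX A hx P st hst)
  obtain ⟨r₀, har⟩ : ∃ r₀, P.1.1 + r₀ = n := ⟨n - P.1.1, by omega⟩
  have h2 : (P.1.1 + 2 * r₀) + P.1.1 = 2 * n := by omega
  have hprim : lefschetzPow D.Hη (r₀ + 1) P.1.1 ξ = 0 := by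
    have h := (primitivePart_mem (D.hLℂ hX) (subsingleton_of_lt hX ℂ) P x).2 (r₀ + 1)
      (P.1.1 + 2 * (r₀ + 1)) rfl (by omega)
    rwa [lefschetzPowTo_eq_lefschetzPow] at h
  obtain ⟨t, ht, heq⟩ := D.hodgeRiemann_X hX har h2 hξT hξ0 hprim
  refine ⟨t, ht.le, fun _ ↦ ht, ?_⟩
  have h := congrArg (D.cTrace hX) heq
  rw [LinearMap.map_smul, LinearMap.map_smul, smul_eq_mul, smul_eq_mul] at h
  rw [hodgeRiemannPairing_apply (D.cTrace hX) har rfl h2, lefschetzPowTo_eq_lefschetzPow, ← hst, ← mul_assoc]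
  exact h

/-- **Second Hodge–Riemann relation for `Q_ℂ`**: for a NON-ZERO `x ∈ Hᵏ(X(ℂ); ℂ)` of `A`-type
`(p, q)`, `i^{p-q} Q_ℂ(x, x̄)` is a positive real (the sum over the Lefschetz components of the
terms of `hodgeRiemannPairing_primitivePart`, one of which is non-zero by the Lefschetz decomposition
`x = ∑ Lᵗ ξ_P x`; `conj` commutes with the primitive parts). [cite: VoisinHodgeI2002, §6.3.2 Thm. 6.32 and §7.1.2] -/
theorem cform_conj_pos (hX : Motives.IsSmoothProjective n X) (A : HodgeModel n X) {k p q : ℕ}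
    (hpq : (p, q) ∈ Finset.HasAntidiagonal.antidiagonal k) {x : complexBetti X k}
    (hx : x ∈ A.typePiece k ⟨(p, q), hpq⟩) (hx0 : x ≠ 0) :
    ∃ r : ℝ, 0 < r ∧ Complex.I ^ ((p : ℤ) - q) * D.cform hX k x (conjClass _ k x) = r := by
  classical
  set pq : ↥(Finset.HasAntidiagonal.antidiagonal k) := ⟨(p, q), hpq⟩ with hpqdef
  change ∃ r : ℝ, 0 < r ∧ Complex.I ^ ((pq.1.1 : ℤ) - pq.1.2) * D.cform hX k x (conjClass _ k x) = r
  obtain ⟨hθre, hθim⟩ := D.cTrace_topClass_pos hX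
  choose tP h0 hpos heq using fun P ↦ D.hodgeRiemannPairing_primitivePart hX A hx P
  have hex : ∃ P, primitivePart D.Hη n (D.hLℂ hX) (subsingleton_of_lt hX ℂ) P x ≠ 0 := by
    by_contra hall
    push Not at hall
    apply hx0
    rw [← sum_lefschetzPowTo_primitivePart (D.hLℂ hX) (subsingleton_of_lt hX ℂ) x]
    exact Finset.sum_eq_zero fun P _ ↦ by rw [hall P, LinearMap.map_zero]
  obtain ⟨P₀, hP₀⟩ := hex
  refine ⟨(∑ P, tP P) * (D.cTrace hX D.topClass).re,
    mul_pos (Finset.sum_pos' (fun P _ ↦ h0 P) ⟨P₀, Finset.mem_univ _, hpos P₀ hP₀⟩) hθre, ?_⟩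
  have hθ : D.cTrace hX D.topClass = ((D.cTrace hX D.topClass).re : ℂ) :=
    Complex.ext (by simp) (by simp [hθim])
  rw [cform, polarizationForm_apply, Finset.mul_sum]
  calc ∑ P, Complex.I ^ ((pq.1.1 : ℤ) - pq.1.2) *
        hodgeRiemannPairing D.Hη n (D.cTrace hX) P.1.1
          (primitivePart D.Hη n (D.hLℂ hX) (subsingleton_of_lt hX ℂ) P x)
          (primitivePart D.Hη n (D.hLℂ hX) (subsingleton_of_lt hX ℂ) P (conjClass _ k x))
      = ∑ P, (tP P : ℂ) * D.cTrace hX D.topClass :=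
        Finset.sum_congr rfl fun P _ ↦ by rw [← D.conjClass_primitivePart hX P x, heq P]
    _ = (((∑ P, tP P) * (D.cTrace hX D.topClass).re : ℝ) : ℂ) := by
        rw [← Finset.sum_mul, hθ]
        push_cast
        rfl

/-- **First Hodge–Riemann relation for `Q_ℂ`**: `Q_ℂ(x, y) = 0` for `A^* x ∈ Fʳ`, `A^* y ∈ F^{r'}`
with `r + r' ≥ k + 1`. Each term `τ(L^{n-a} ξ_P x ∪ ξ_P y)` vanishes type by type: the
`(s, ·)`-component of `ξ_P x` vanishes unless `s + t ≥ r` (the components of `x` of type `(p, ·)`,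
`p < r`, vanish, and `ξ_P` shifts types by `(-t, -t)`), likewise for `y`, so the surviving cup products
have first Hodge index `≥ (r + r' - 2t) + (n - a) ≥ n + 1` and vanish in `H^{2n}`.
[cite: VoisinHodgeI2002, §7.1.2 and §6.3.2 Lemma 6.31] -/
theorem cform_eq_zero_of_filtration (hX : Motives.IsSmoothProjective n X) (A : HodgeModel n X)
    {k r r' : ℕ} (hrr : k + 1 ≤ r + r') {x y : complexBetti X k}
    (hx : A.pullback k x ∈ A.hodgeFiltration k r) (hy : A.pullback k y ∈ A.hodgeFiltration k r') :
    D.cform hX k x y = 0 := by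
  classical
  have hup := isOfHodgeType_lefschetzOperator_of_cupPreservesHodgeType
    (cupPreservesHodgeType_of_hodgeModel hX D.B) D.isOfHodgeType_Hη
  -- the low-type components of the primitive parts vanish
  have claim : ∀ {r₁ : ℕ} {z : complexBetti X k}, A.pullback k z ∈ A.hodgeFiltration k r₁ →
      ∀ (P : {p : ℕ × ℕ // p.1 + 2 * p.2 = k}) (st : ↥(Finset.HasAntidiagonal.antidiagonal P.1.1)),
        st.1.1 + P.1.2 < r₁ →
          A.typeProj P.1.1 st (primitivePart D.Hη n (D.hLℂ hX) (subsingleton_of_lt hX ℂ) P z) = 0 := by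
    intro r₁ z hz P st hst
    conv_lhs => rw [← A.sum_typeProj k z]
    rw [map_sum, map_sum]
    refine Finset.sum_eq_zero fun pq _ ↦ ?_
    rcases lt_or_ge pq.1.1 r₁ with hlt | hge
    · rw [A.typeProj_eq_zero_of_mem_hodgeFiltration hz pq hlt, LinearMap.map_zero, LinearMap.map_zero]
    · have hmem := A.typeProj_mem k pq z
      have hpq := Finset.HasAntidiagonal.mem_antidiagonal.1 pq.2
      have hP2 := P.2
      by_cases hty : P.1.2 ≤ pq.1.1 ∧ P.1.2 ≤ pq.1.2
      · obtain ⟨ht1, ht2⟩ := hty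
        let st₁ : ↥(Finset.HasAntidiagonal.antidiagonal P.1.1) :=
          ⟨(pq.1.1 - P.1.2, pq.1.2 - P.1.2), Finset.HasAntidiagonal.mem_antidiagonal.2 (by simp only; omega)⟩
        have hst₁ : (st₁.1.1 : ℤ) - st₁.1.2 = (pq.1.1 : ℤ) - pq.1.2 := by
          simp only [st₁]; push_cast [ht1, ht2]; ring
        have h1 := D.primitivePart_mem_typePiece hX A hmem P st₁ hst₁
        refine A.typeProj_apply_of_mem_ne (fun heq ↦ ?_) h1
        have h' := congrArg (fun i : ↥(Finset.HasAntidiagonal.antidiagonal P.1.1) ↦ i.1.1) heq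
        simp only [st₁] at h'
        omega
      · rw [D.primitivePart_eq_zero_of_no_type hX A hmem P (fun st₂ h ↦ hty ?_), LinearMap.map_zero]
        have h1 := Finset.HasAntidiagonal.mem_antidiagonal.1 st₂.2
        constructor <;> omega
  rw [cform, polarizationForm_apply]
  refine Finset.sum_eq_zero fun P _ ↦ ?_
  rcases le_or_gt P.1.1 n with ha | ha
  swap
  · rw [hodgeRiemannPairing_of_lt _ ha, LinearMap.zero_apply, LinearMap.zero_apply]
  obtain ⟨s₀, has⟩ : ∃ s₀, P.1.1 + s₀ = n := ⟨n - P.1.1, by omega⟩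
  have h : (P.1.1 + 2 * s₀) + P.1.1 = 2 * n := by omega
  rw [hodgeRiemannPairing_apply _ has rfl h, lefschetzPowTo_eq_lefschetzPow]
  set ξx := primitivePart D.Hη n (D.hLℂ hX) (subsingleton_of_lt hX ℂ) P x
  set ξy := primitivePart D.Hη n (D.hLℂ hX) (subsingleton_of_lt hX ℂ) P y
  suffices hcup : cupProduct h (lefschetzPow D.Hη s₀ P.1.1 ξx) ξy = 0 by
    rw [hcup, LinearMap.map_zero, mul_zero]
  -- every pair of type components contributes `0`
  have hterm : ∀ st st' : ↥(Finset.HasAntidiagonal.antidiagonal P.1.1),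
      cupProduct h (lefschetzPow D.Hη s₀ P.1.1 (A.typeProj P.1.1 st ξx)) (A.typeProj P.1.1 st' ξy) = 0 := by
    intro st st'
    have hP2 := P.2
    have hst := Finset.HasAntidiagonal.mem_antidiagonal.1 st.2
    have hst' := Finset.HasAntidiagonal.mem_antidiagonal.1 st'.2
    rcases lt_or_ge (st.1.1 + P.1.2) r with h1 | h1
    · rw [claim hx P st h1, LinearMap.map_zero, LinearMap.map_zero, LinearMap.zero_apply]
    rcases lt_or_ge (st'.1.1 + P.1.2) r' with h2 | h2
    · rw [claim hy P st' h2, LinearMap.map_zero]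
    -- the surviving cup product has first Hodge index `> n`, hence vanishes in `H^{2n}`
    have hT : IsOfHodgeType n X (2 * n) (st.1.1 + s₀ + st'.1.1) (st.1.2 + s₀ + st'.1.2)
        (cupProduct h (lefschetzPow D.Hη s₀ P.1.1 (A.typeProj P.1.1 st ξx)) (A.typeProj P.1.1 st' ξy)) :=
      cupPreservesHodgeType_of_hodgeModel hX D.B h
        (isOfHodgeType_lefschetzPow_of_lefschetzOperator hup s₀ P.1.1 st.1.1 st.1.2 _
          (A.isOfHodgeType_of_mem_typePiece (A.typeProj_mem P.1.1 st ξx)))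
        (A.isOfHodgeType_of_mem_typePiece (A.typeProj_mem P.1.1 st' ξy))
    have hmem := A.mem_typePiece_of_isOfHodgeType hodgePQ_independent_of_hodgeModel_holds hX
      (Finset.HasAntidiagonal.mem_antidiagonal.2
        (by omega : (st.1.1 + s₀ + st'.1.1) + (st.1.2 + s₀ + st'.1.2) = 2 * n)) hT
    rwa [A.typePiece_eq_bot_of_lt_fst _ (by simp only; omega), Submodule.mem_bot] at hmem
  conv_lhs => rw [← A.sum_typeProj P.1.1 ξx, ← A.sum_typeProj P.1.1 ξy]
  simp only [map_sum, LinearMap.sum_apply, hterm, Finset.sum_const_zero]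

/-! ### The polarisation of `Hᵏ(X(ℂ); ℚ)` -/

/-- Conjugation on `ℂ ⊗_ℚ Hᵏ(X(ℂ); ℚ)` corresponds to `conjClass` on `Hᵏ(X(ℂ); ℂ)` under
`ofRatClassBaseChange` (`HodgeModel.complexification_conj`, through any model). [cite: VoisinHodgeI2002, Cor. 6.12] -/
theorem ofRatClassBaseChange_conj (hX : Motives.IsSmoothProjective n X) (A : HodgeModel n X) {k : ℕ}
    (x : ℂ ⊗[ℚ] singularCohomology ℚ ℚ (Motives.ComplexPoints X) k) :
    ofRatClassBaseChange _ k (Motives.HodgeStructure.conj x) = conjClass _ k (ofRatClassBaseChange _ k x) := by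
  apply A.pullback_injective k
  rw [← A.complexification_apply hX, A.complexification_conj hX, A.complexification_apply hX]
  change _ = singularCohomology.map ℂ ℂ _ k (conjClass _ k _)
  rw [← conjClass_map]

/-- **The polarisation of the Hodge structure `A.hodgeStructure hX hA k` on `Hᵏ(X(ℂ); ℚ)`** by the form
`Q` of the datum (Voisin I §7.1.2): `(-1)ᵏ`-symmetric (`polarizationForm_flip`), `Q_ℂ(Fᵖ, F^{k+1-p}) = 0`
(`cform_eq_zero_of_filtration`) and `i^{p-q} Q_ℂ(x, x̄) > 0` on `V^{p,q} ∖ 0` (`cform_conj_pos`), the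
pieces and the filtration of `A.hodgeStructure` being read in `A` through `Θ_A = A^* ∘ ofRatClassBaseChange`.
[cite: VoisinHodgeI2002, §7.1.2] [cite: DeligneHodgeII1971, 2.1.15] -/
def polarization (hX : Motives.IsSmoothProjective n X) (A : HodgeModel n X) (hA : A.IsHodgeSymmetric) (k : ℕ) :
    (A.hodgeStructure hX hA k).Polarization where
  form := D.form hX k
  flip_form := by
    refine LinearMap.ext fun v ↦ LinearMap.ext fun w ↦ ?_
    rw [LinearMap.BilinForm.flip_apply, LinearMap.smul_apply, LinearMap.smul_apply, form, polarizationForm_flip,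
      Int.coe_negOnePow_natCast, zsmul_eq_mul, Int.cast_pow, Int.cast_neg, Int.cast_one]
  form_apply_eq_zero p x hx y hy := by
    rw [HodgeModel.hodgeStructure_F, HodgeModel.mem_ratF_iff, HodgeModel.complexification_apply] at hx hy
    rw [D.form_baseChange hX]
    refine D.cform_eq_zero_of_filtration hX A ?_ hx hy
    have h1 := Int.self_le_toNat p
    have h2 := Int.self_le_toNat ((k : ℤ) + 1 - p)
    omega
  pos p q hpq x hx hx0 := by
    -- off the first quadrant the pieces vanish
    rcases lt_or_ge p 0 with hp | hp
    · exfalso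
      have hq : (k : ℤ) < q := by omega
      have h := (A.hodgeStructure hX hA k).piece_le_complexConj_F p q hx
      rw [HodgeModel.hodgeStructure_F, A.ratF_eq_bot hX k hq, Motives.HodgeStructure.complexConj_bot,
        Submodule.mem_bot] at h
      exact hx0 h
    rcases lt_or_ge q 0 with hq | hq
    · exfalso
      have hp' : (k : ℤ) < p := by omega
      have h := (A.hodgeStructure hX hA k).piece_le_F p q hx
      rw [HodgeModel.hodgeStructure_F, A.ratF_eq_bot hX k hp', Submodule.mem_bot] at h
      exact hx0 h
    obtain ⟨p₀, rfl⟩ := Int.eq_ofNat_of_zero_le hp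
    obtain ⟨q₀, rfl⟩ := Int.eq_ofNat_of_zero_le hq
    have hpq₀ : p₀ + q₀ = k := by exact_mod_cast hpq
    rw [A.piece_eq_ratPiece hX hA hpq₀, HodgeModel.mem_ratPiece_iff, HodgeModel.complexification_apply] at hx
    -- `x' = Θ x` is a non-zero class of `A`-type `(p₀, q₀)`
    have hx' : ofRatClassBaseChange _ k x ∈ A.typePiece k ⟨(p₀, q₀), Finset.HasAntidiagonal.mem_antidiagonal.2 hpq₀⟩ := hx
    have hx0' : ofRatClassBaseChange _ k x ≠ 0 := fun h ↦
      hx0 (ofRatClassBaseChange_injective _ k (by rw [h, map_zero]))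
    obtain ⟨r, hr, heq⟩ := D.cform_conj_pos hX A _ hx' hx0'
    refine ⟨r, hr, ?_⟩
    rw [zpow_sub₀ Complex.I_ne_zero, div_eq_mul_inv] at heq
    rw [D.form_baseChange hX, ofRatClassBaseChange_conj hX A]
    exact heq

end KaehlerRationalDatum

/-- **The Hodge structure on `Hᵏ(X(ℂ); ℚ)` of a smooth projective complex variety is polarisable**
(Voisin I §7.1.2; Deligne, Hodge II 2.1.15) — discharge of the named fact
`smoothProjective_hodgeStructure_isPolarizable`: for `Y` smooth projective of dimension `m`, every
Hodge-symmetric model `A` and every degree `k`, `A.hodgeStructure hY hA k` admits the polarisation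
`KaehlerRationalDatum.polarization` of any Kähler–rational datum (`nonempty_kaehlerRationalDatum`).
[cite: VoisinHodgeI2002, §7.1.2] [cite: DeligneHodgeII1971, 2.1.15] -/
theorem smoothProjective_hodgeStructure_isPolarizable_holds : smoothProjective_hodgeStructure_isPolarizable := by
  intro m Y hY A hA k
  obtain ⟨D⟩ := nonempty_kaehlerRationalDatum hY
  exact ⟨D.polarization hY A hA k⟩

/-! ### Consequences -/

/-- **Voisin (2025), Cor. 2.12 — the named fact `Voisin2025_hodgeClass_lift_complexGysin` holds**:
its assembly `Voisin2025_hodgeClass_lift_complexGysin_holds_of` fed with the theorems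
`exists_isReal_hodgeModel_holds`, `exists_deRhamIsoFamily_holds` (de Rham, Warner Thm. 5.36/5.45) and
`smoothProjective_hodgeStructure_isPolarizable_holds`. [cite: Voisin2025, Cor. 2.12, Prop. 2.11 and proof of Prop. 3.8]
[cite: VoisinHodgeI2002, Lemma 7.26 and §7.3.2] -/
theorem Voisin2025_hodgeClass_lift_complexGysin_holds : Voisin2025_hodgeClass_lift_complexGysin :=
  Voisin2025_hodgeClass_lift_complexGysin_holds_of exists_isReal_hodgeModel_holds
    (fun E _ _ _ ↦ Literature.NumberTheory.Transcendental.exists_deRhamIsoFamily_holds E)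
    smoothProjective_hodgeStructure_isPolarizable_holds

/-- **`curveNetSaitoData_nonempty` from Deligne's Cor. 8.2.8 alone**: with real Hodge models, de
Rham's theorem and the polarizability all proved, the only remaining hypothesis of
`curveNetSaitoData_nonempty_holds_of` is the named fact
`Deligne1974_ker_restrictCompl_eq_iSup_range_complexGysin` (Hodge III, Cor. 8.2.8).
[cite: Saito1990, Thm. 0.1–0.2, §2.g and §4.5] [cite: DeligneHodgeIII1974, Cor. 8.2.8] -/
theorem curveNetSaitoData_nonempty_of_deligne (hD : Deligne1974_ker_restrictCompl_eq_iSup_range_complexGysin) :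
    curveNetSaitoData_nonempty :=
  curveNetSaitoData_nonempty_holds_of exists_isReal_hodgeModel_holds hD
    (fun E _ _ _ ↦ Literature.NumberTheory.Transcendental.exists_deRhamIsoFamily_holds E)
    smoothProjective_hodgeStructure_isPolarizable_holds

end HodgeTheory

end Literature.AlgebraicGeometry.HodgeTheory
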